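import Summits.PneNP.PneNP.Theorems.NegLimitedNearMarkovHalving
import Summits.PneNP.PneNP.Theorems.NegLimitedNearMarkovLanguage
import Literature.Computability.Complexity.MarkovInversion
import Literature.Barriers.PneNP.MonotoneGapLowerBoundProofs

/-!
# Route NegLimited, rung T4 — `NeglimitedNearMarkovNegations` (stmt-PneNP-19862) PROVED

The as-typed (unguarded) negation ladder closes up to `log₂ n - 32 log₂ log₂ n` NOT gates: ONE
explicit language `L ∈ P ⊆ NP` (`nearMarkovLang F`, the parity of `2^{budget}` Tardos blocks,
`NegLimitedNearMarkovLanguage.lean`) whose slices at the lengths `n = 2^a` need De Morgan circuits of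
size `> n^k` when at most `⌊log₂ n⌋ - 32 ⌊log₂ ⌊log₂ n⌋⌋` NOT gates are allowed, for every `k`,
infinitely often (`neglimitedNearMarkovNegations`, and the item BY NAME:
`Summit.PneNP.PneNP.Theorems.neglimitedNearMarkovNegations_holds`).

Assembly (cell record HOME/pnp-ideate-p3/ROUND-4.md §2.4/§7.5, ERRATUM-P3-F5):
* Part A — Markov admissibility: the parity of a monotone block count `N ≤ K` has decrease
  `d ≤ K - 1` (`decrease_bodd_le`: along a chain every jump down strictly increases `N`, and `N` is
  odd, so positive, at a jump), hence (`markov_upper_holds`) a De Morgan circuit with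
  `⌈log₂ K⌉ = budget` NOT gates exists and `negLimitedSizeOver` is attained, not the junk `0`
  (`exists_circuit_negationCount_le`).
* Part B — designed lengths `n = 2^a`, `a ≥ 32 ⌊log₂ a⌋`: block length `s = 2^{32ℓ} = m²`,
  `m = 2^{16ℓ}`, `ℓ = ⌊log₂ a⌋`, block count `K = 2^{a - 32ℓ} = 2^{budget}`, `K · s = n`.
* Part C — the lower bound at a designed length (`le_negLimitedSizeOver_of_blocks`): the slice is
  the parity fold of `K` copies of Tardos's clique-like function `T_m` read through the
  upper-triangle retraction of `NegLimitedLoglogSlices.lean`; by the ⊕-halving lemma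
  (`NegLimitedNearMarkovHalving.lean`) every admissible circuit is at least as large as a monotone
  circuit for `T_m`, i.e. (`Jukna2012_cliqueLike_sqrt_lowerBound_holds`, Alon–Boppana for
  clique-like functions) has `≥ 2^{c m^{1/8}} = 2^{c 2^{2ℓ}} > 2^{a k} = n^k` gates (Part D numerics).

References: S. Jukna, *Boolean Function Complexity* (2012), §10.2 (Markov), §10.5 Thm. 10.21 /
Claim 10.22 (PDF pp. 303–311), Thm. 9.26/9.28 (PDF pp. 283–286) [Jukna2012]; É. Tardos,
Combinatorica 8 (1988) 141–142 [Tardos1988]; A. A. Markov, J. ACM 5 (1958) [Markov1958].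
-/

set_option linter.dupNamespace false

noncomputable section

namespace Summit.PneNP.PneNP.Theorems.NegLimNearMarkov

open Finset Literature.Computability.Complexity Literature.Computability.Complexity.GateList
  Literature.Barriers.PneNP Summit.PneNP.PneNP.Theorems.NegLimSlices Filter

/-! ## Part A — Markov admissibility of parity folds -/

/-- Along a strict chain starting at `a`, the parity `f` of a monotone count `N ≤ K` jumps down
at most `K - N a` times, and at most `K - N a - 1` times if `f a = 0`. [folklore] -/
theorem jumpsDown_bodd_le {n K : ℕ} {N : (Fin n → Bool) → ℕ} (hN : Monotone N)
    (hK : ∀ x, N x ≤ K) {f : (Fin n → Bool) → Bool} (hf : ∀ x, f x = Nat.bodd (N x)) :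
    ∀ (a : Fin n → Bool) (l : List (Fin n → Bool)), (a :: l).IsChain (· < ·) →
      jumpsDown f (a :: l) ≤ K - N a - (!f a).toNat
  | a, [], _ => by simp [jumpsDown]
  | a, b :: l, hl => by
    have hab : a < b := List.IsChain.rel hl
    have ih := jumpsDown_bodd_le hN hK hf b l hl.tail
    have hNab : N a ≤ N b := hN hab.le
    have hNb : N b ≤ K := hK b
    have hne : f a ≠ f b → N a < N b := fun h =>
      lt_of_le_of_ne hNab fun h' => h (by rw [hf, hf, h'])
    have hstep : jumpsDown f (a :: b :: l) =
        (if f a = true ∧ f b = false then 1 else 0) + jumpsDown f (b :: l) := rfl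
    rw [hstep]
    cases ha : f a <;> cases hb : f b <;> simp [ha, hb] at ih hne ⊢ <;> omega

/-- **The decrease of the parity of a monotone count `N ≤ K` is at most `K - 1`.** [folklore] -/
theorem decrease_bodd_le {n K : ℕ} {N : (Fin n → Bool) → ℕ} (hN : Monotone N)
    (hK : ∀ x, N x ≤ K) {f : (Fin n → Bool) → Bool} (hf : ∀ x, f x = Nat.bodd (N x)) :
    decrease f ≤ K - 1 := by
  refine csSup_le ⟨0, [], List.IsChain.nil, rfl⟩ ?_
  rintro _ ⟨l, hl, rfl⟩
  cases l with
  | nil => simp [jumpsDown]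
  | cons a l =>
    have h := jumpsDown_bodd_le hN hK hf a l hl
    have h1 : f a = true → 1 ≤ N a := fun ha => by
      rw [hf] at ha
      rcases Nat.eq_zero_or_pos (N a) with h0 | h0
      · rw [h0] at ha; exact absurd ha (by decide)
      · exact h0
    cases ha : f a
    · rw [ha] at h; simp only [Bool.not_false, Bool.toNat_true] at h; omega
    · rw [ha] at h; have := h1 ha; simp only [Bool.not_true, Bool.toNat_false] at h; omega

/-- **Markov admissibility**: the parity of a monotone block count `N ≤ K ≤ 2^R`, if not constant,
is computed by a De Morgan circuit with at most `R` NOT gates (`markov_upper_holds` with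
`⌈log₂ (d + 1)⌉ ≤ ⌈log₂ K⌉ ≤ R`). [cite: Jukna2012, §10.2 Thm. (Markov 1957)] -/
theorem exists_circuit_negationCount_le {n K R : ℕ} {N : (Fin n → Bool) → ℕ} (hN : Monotone N)
    (hK : ∀ x, N x ≤ K) (hKR : K ≤ 2 ^ R) {f : (Fin n → Bool) → Bool}
    (hf : ∀ x, f x = Nat.bodd (N x)) (hnc : ∃ x y, f x ≠ f y) :
    ∃ C : Circuit (Fin n), C.IsOver deMorganBasis ∧ C.negationCount ≤ R ∧ C.Computes f := by
  obtain ⟨C, hB, hC, hneg⟩ := markov_upper_holds f hnc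
  refine ⟨C, hB, hneg.trans ?_, hC⟩
  have hd := decrease_bodd_le hN hK hf
  have h1 : decrease f + 1 ≤ 2 ^ R := by have := Nat.one_le_two_pow (n := R); omega
  calc Nat.clog 2 (decrease f + 1) ≤ Nat.clog 2 (2 ^ R) := Nat.clog_mono_right 2 h1
    _ = R := Nat.clog_pow 2 R one_lt_two

/-! ## Part B — the designed lengths `n = 2^a` -/

/-- `32 t ≤ 2^t` for `t ≥ 8`. [folklore] -/
theorem thirtytwo_mul_le_two_pow {t : ℕ} (ht : 8 ≤ t) : 32 * t ≤ 2 ^ t := by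
  obtain ⟨j, rfl⟩ : ∃ j, t = j + 8 := ⟨t - 8, by omega⟩
  have h1 : j < 2 ^ j := Nat.lt_two_pow_self
  rw [pow_add]
  norm_num
  nlinarith

/-- `32 ⌊log₂ a⌋ ≤ a` for `a ≥ 256`. [folklore] -/
theorem thirtytwo_mul_log_le {a : ℕ} (ha : 256 ≤ a) : 32 * Nat.log 2 a ≤ a := by
  have h8 : 8 ≤ Nat.log 2 a := Nat.le_log_of_pow_le one_lt_two (by norm_num [ha])
  exact (thirtytwo_mul_le_two_pow h8).trans (Nat.pow_log_le_self 2 (by omega))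

/-- `m · m = s`: `2^{16ℓ} · 2^{16ℓ} = 2^{32ℓ}`. [folklore] -/
theorem m_mul_m (ℓ : ℕ) : 2 ^ (16 * ℓ) * 2 ^ (16 * ℓ) = 2 ^ (32 * ℓ) := by
  rw [← pow_add]; ring_nf

/-- `K · s = n`: `2^{a - 32ℓ} · (2^{16ℓ})² = 2^a` when `32ℓ ≤ a`. [folklore] -/
theorem blocks_mul_blockLen {a : ℕ} (h32 : 32 * Nat.log 2 a ≤ a) :
    2 ^ (a - 32 * Nat.log 2 a) * (2 ^ (16 * Nat.log 2 a) * 2 ^ (16 * Nat.log 2 a)) = 2 ^ a := by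
  rw [m_mul_m, ← pow_add, Nat.sub_add_cancel h32]

/-- The block length at a designed length: `s(2^a) = 2^{32ℓ} = m · m`. [folklore] -/
theorem nmBlockLen_two_pow {a : ℕ} (h32 : 32 * Nat.log 2 a ≤ a) :
    nmBlockLen (2 ^ a) = 2 ^ (16 * Nat.log 2 a) * 2 ^ (16 * Nat.log 2 a) := by
  rw [nmBlockLen, Nat.log_pow one_lt_two, m_mul_m]
  have h1 : 2 ^ (32 * Nat.log 2 a) ≤ 2 ^ a := Nat.pow_le_pow_right two_pos h32
  have h2 : 1 ≤ 2 ^ (32 * Nat.log 2 a) := Nat.one_le_two_pow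
  rw [min_eq_left (by omega)]
  omega

/-- The block count at a designed length: `K(2^a) = 2^{a - 32ℓ}`. [folklore] -/
theorem nmBlocks_two_pow {a : ℕ} (h32 : 32 * Nat.log 2 a ≤ a) :
    nmBlocks (2 ^ a) = 2 ^ (a - 32 * Nat.log 2 a) := by
  rw [nmBlocks, nmBlockLen_two_pow h32, m_mul_m, Nat.pow_div h32 two_pos]

/-! ## Part C — the lower bound at a designed length -/

/-- `{∧₂, ∨₂}`-circuits witness the values of a clique-like function at the constant inputs.
[folklore] -/
theorem cliqueLike_apply_const {m : ℕ} (hm : 4 ≤ m) {T : (KEdge m → Bool) → Bool}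
    (hT : CliqueLike (univ : Finset (Fin m)) (Nat.sqrt m - 1) (Nat.sqrt m) T) (b : Bool) :
    T (fun _ => b) = b := by
  have hk : 2 ≤ Nat.sqrt m := Nat.le_sqrt'.2 (by omega)
  obtain ⟨C₀, hB₀, hC₀⟩ := exists_monotone_circuit_of_cliqueLike hT (by omega) (Nat.sqrt_le_self m)
  rw [← hC₀]
  exact C₀.eval_const_of_isOver_monotoneBasis hB₀ b

/-- A range filter counted through `Fin`. [folklore] -/
theorem card_filter_range_eq_card_filter_univ (K : ℕ) (P : ℕ → Prop) [DecidablePred P] :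
    #((range K).filter P) = #((univ : Finset (Fin K)).filter fun j : Fin K => P (j : ℕ)) := by
  have h : (univ.filter fun j : Fin K => P (j : ℕ)).map Fin.valEmbedding = (range K).filter P := by
    ext i
    simp only [Finset.mem_map, Finset.mem_filter, Finset.mem_univ, true_and, Finset.mem_range,
      Fin.valEmbedding_apply]
    constructor
    · rintro ⟨j, hP, rfl⟩
      exact ⟨j.2, hP⟩
    · rintro ⟨hi, hP⟩
      exact ⟨⟨i, hi⟩, hP, rfl⟩
  rw [← h, Finset.card_map]

/-- **The blocks of a slice input at a designed length are read by Tardos's function.** With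
`s(n) = m²`, `K(n) = K` and `n = K · m²`, block `j < K` of the input word of `x` is the bit matrix
`q ↦ x_{(j,q)}`, and the Tardos witness language accepts it iff `T_m` accepts its edge vector.
[folklore] -/
theorem boolIndicator_nmBlock {F : List Bool → List Bool} (hF : IsThetaApprox F) {m K : ℕ}
    (hm : 1 ≤ m) (hs : nmBlockLen (K * (m * m)) = m * m) (hK : nmBlocks (K * (m * m)) = K)
    (x : Fin (K * (m * m)) → Bool) (j : Fin K) :
    (witnessLang F).boolIndicator (nmBlock (List.ofFn x) j) =
      tardosFn (approxOf F m) (Nat.sqrt m) (edgeVec fun q => x (finProdFinEquiv (j, q))) := by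
  rw [← sliceFn_witnessLang hF hm, nmBlock_ofFn x (by rw [hK]; exact j.2)]
  show (witnessLang F).boolIndicator _ = (witnessLang F).boolIndicator _
  congr 1
  apply List.ext_getElem
  · simp [hs]
  · intro i h1 h2
    simp only [List.getElem_ofFn]
    congr 1
    apply Fin.ext
    simp only [finProdFinEquiv_apply_val, hs]
    ring

/-- **The slice at a designed length is the parity of the accepting Tardos blocks.** [folklore] -/
theorem sliceFn_eq_bodd_card {F : List Bool → List Bool} (hF : IsThetaApprox F) {m K : ℕ}
    (hm : 1 ≤ m) (hs : nmBlockLen (K * (m * m)) = m * m) (hK : nmBlocks (K * (m * m)) = K)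
    (x : Fin (K * (m * m)) → Bool) :
    (nearMarkovLang F).sliceFn (K * (m * m)) x = Nat.bodd #((univ : Finset (Fin K)).filter fun j =>
      tardosFn (approxOf F m) (Nat.sqrt m) (edgeVec fun q => x (finProdFinEquiv (j, q))) = true) := by
  rw [sliceFn_nearMarkovLang, hK, card_filter_range_eq_card_filter_univ (P := fun j =>
    (witnessLang F).boolIndicator (nmBlock (List.ofFn x) j) = true)]
  congr 2
  refine Finset.filter_congr fun j _ => ?_
  rw [boolIndicator_nmBlock hF hm hs hK x j]

/-- **The negation-limited lower bound at a designed length.** If `s(n) = m²`, `K(n) = 2^R`,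
`n = 2^R · m²` (`m ≥ 4`) and every monotone circuit for every `(⌊√m⌋-1, ⌊√m⌋)`-clique-like
function has at least `S` gates, then every De Morgan circuit with at most `R` NOT gates for the
slice `L_n` of the witness language has at least `S` gates, and such circuits exist:
`S ≤ negLimitedSizeOver deMorganBasis R L_n`. [cite: Jukna2012, Thm. 10.21 with Claim 10.22 (PDF pp. 310–311)] -/
theorem le_negLimitedSizeOver_of_blocks {F : List Bool → List Bool} (hF : IsThetaApprox F)
    {m R : ℕ} (hm : 4 ≤ m) (hs : nmBlockLen (2 ^ R * (m * m)) = m * m)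
    (hK : nmBlocks (2 ^ R * (m * m)) = 2 ^ R) {S : ℕ}
    (hlow : ∀ f : (KEdge m → Bool) → Bool,
      CliqueLike (univ : Finset (Fin m)) (Nat.sqrt m - 1) (Nat.sqrt m) f →
      ∀ C : Circuit (KEdge m), C.IsOver monotoneBasis → C.Computes f → S ≤ C.size) :
    S ≤ negLimitedSizeOver deMorganBasis R ((nearMarkovLang F).sliceFn (2 ^ R * (m * m))) := by
  set K := 2 ^ R with hKdef
  have hm1 : 1 ≤ m := by omega
  have hk2 : 2 ≤ Nat.sqrt m := Nat.le_sqrt'.2 (by omega)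
  -- Tardos's clique-like block function
  set T := tardosFn (approxOf F m) (Nat.sqrt m) with hT
  have hTcl : CliqueLike (univ : Finset (Fin m)) (Nat.sqrt m - 1) (Nat.sqrt m) T :=
    cliqueLike_tardosFn (by omega) (by omega) _ fun G => approxOf_spec hF hm1 G
  have hT0 : T (fun _ => false) = false := cliqueLike_apply_const hm hTcl false
  have hT1 : T (fun _ => true) = true := cliqueLike_apply_const hm hTcl true
  -- the edges numbered
  set M := Fintype.card (KEdge m) with hM
  let eM : KEdge m ≃ Fin M := Fintype.equivFin (KEdge m)
  let Tfin : (Fin M → Bool) → Bool := fun y => T fun e => y (eM e)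
  have hTfin_mono : Monotone Tfin := fun y y' h => hTcl.mono fun e => h (eM e)
  have hTfin_nc : ∃ x y, Tfin x ≠ Tfin y :=
    ⟨fun _ => false, fun _ => true, by
      show T (fun _ => false) ≠ T (fun _ => true)
      rw [hT0, hT1]; exact Bool.false_ne_true⟩
  -- the slice as a parity of block values
  have hslice := sliceFn_eq_bodd_card hF hm1 hs hK
  -- the retraction onto `Fin K × Fin M`
  have e₀ : KEdge m := ⟨s(⟨0, by omega⟩, ⟨1, by omega⟩), by simp [Fin.ext_iff]⟩
  let e : Fin (K * (m * m)) → Fin K × Fin M := fun p =>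
    ((finProdFinEquiv.symm p).1, eM (edgeOfPos e₀ (finProdFinEquiv.symm p).2))
  refine le_negLimitedSizeOver_of_retract (g := parityFold K M Tfin) e (fun y => ?_) ?_ ?_
  · -- every circuit for the slice, re-wired along `e`, computes the parity fold
    rw [hslice, parityFold_apply]
    congr 2
    refine Finset.filter_congr fun j _ => ?_
    have hblk : (edgeVec fun q => y (e (finProdFinEquiv (j, q)))) = fun e' => y (j, eM e') := by
      simp only [e, Equiv.symm_apply_apply]
      exact edgeVec_comp_edgeOfPos e₀ fun e' => y (j, eM e')
    rw [hblk]
  · -- an admissible circuit exists (Markov)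
    refine exists_circuit_negationCount_le (K := K)
      (N := fun x => #((univ : Finset (Fin K)).filter fun j =>
        T (edgeVec fun q => x (finProdFinEquiv (j, q))) = true))
      (fun x x' hxx' => Finset.card_le_card fun j => ?_) (fun x => ?_) le_rfl hslice ?_
    · simp only [mem_filter, mem_univ, true_and]
      intro hj
      have h := hTcl.mono (show (edgeVec fun q => x (finProdFinEquiv (j, q))) ≤
        edgeVec fun q => x' (finProdFinEquiv (j, q)) from fun _ => hxx' _)
      rw [hj] at h
      exact Bool.eq_true_of_true_le h
    · exact (card_filter_le _ _).trans (by simp [K])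
    · -- not constant: no block accepting vs exactly block `0` accepting
      have hK1 : 0 < K := Nat.two_pow_pos R
      refine ⟨fun _ => false, fun p => decide ((finProdFinEquiv.symm p).1 = ⟨0, hK1⟩), ?_⟩
      rw [hslice, hslice]
      have h0 : ((univ : Finset (Fin K)).filter fun j =>
          T (edgeVec fun q => false) = true) = ∅ := by
        refine Finset.filter_eq_empty_iff.2 fun j _ => ?_
        rw [show (edgeVec fun _ : Fin (m * m) => false) = fun _ => false from rfl, hT0]
        exact Bool.false_ne_true
      have h1 : ((univ : Finset (Fin K)).filter fun j : Fin K =>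
          T (edgeVec fun q => decide ((finProdFinEquiv.symm (finProdFinEquiv (j, q))).1 =
            ⟨0, hK1⟩)) = true) = {⟨0, hK1⟩} := by
        ext j
        simp only [Equiv.symm_apply_apply, mem_filter, mem_univ, true_and, mem_singleton]
        by_cases hj : j = ⟨0, hK1⟩
        · simp only [hj, decide_true]
          rw [show (edgeVec fun _ : Fin (m * m) => true) = fun _ => true from rfl, hT1]
          simp
        · simp only [hj, decide_false]
          rw [show (edgeVec fun _ : Fin (m * m) => false) = fun _ => false from rfl, hT0]
          simp
      rw [h0, h1]
      simp
  · -- every admissible circuit for the parity fold is large (⊕-halving + Alon–Boppana)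
    intro D hDB hDg hDneg
    have h1 : CktSize monotoneBasis (fun (y : Fin M → Bool) (_ : Unit) => Tfin y) D.gates.length :=
      cktSize_of_computes_parityFold hTfin_mono hTfin_nc le_rfl D.gates D.output (wf_gates D) hDB
        D.wf_output (by rw [← circuit_negationCount]; exact hDneg)
        (fun x => by rw [← circuit_eval]; exact hDg x)
    have h2 : CktSize monotoneBasis (fun (z : KEdge m → Bool) (_ : Unit) => T z) D.gates.length :=
      (h1.rewire eM.symm).congr fun z _ => by
        show T _ = T z
        congr 1
        funext e'
        simp
    obtain ⟨C, hCB, hCs, hCf⟩ := h2.toCircuit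
    exact (hlow T hTcl C hCB fun z => hCf z).trans hCs

/-! ## Part D — numerics and assembly -/

/-- `m^{1/8} = 2^{2ℓ}` for `m = 2^{16ℓ}`. [folklore] -/
theorem rpow_m_eq (ℓ : ℕ) : (((2 ^ (16 * ℓ) : ℕ) : ℝ)) ^ (1 / 8 : ℝ) = (2 : ℝ) ^ (2 * ℓ) := by
  rw [Nat.cast_pow, Nat.cast_ofNat, ← Real.rpow_natCast, ← Real.rpow_mul (by norm_num),
    ← Real.rpow_natCast]
  congr 1
  push_cast
  ring

/-- `a² < 4 · 2^{2 ⌊log₂ a⌋}`. [folklore] -/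
theorem sq_lt_four_mul_two_pow_log (a : ℕ) : a * a < 4 * 2 ^ (2 * Nat.log 2 a) := by
  have h := Nat.lt_pow_succ_log_self one_lt_two a
  have h2 : a * a < 2 ^ (Nat.log 2 a + 1) * 2 ^ (Nat.log 2 a + 1) :=
    Nat.mul_lt_mul_of_lt_of_lt h h
  calc a * a < 2 ^ (Nat.log 2 a + 1) * 2 ^ (Nat.log 2 a + 1) := h2
    _ = 4 * 2 ^ (2 * Nat.log 2 a) := by rw [← pow_add]; ring_nf

/-- **Numerics**: `n^k + 1 ≤ 2^{c m^{1/8}}` at `n = 2^a`, `m = 2^{16 ⌊log₂ a⌋}`, as soon as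
`c · a ≥ 4k + 4` (`a ≥ 1`). [folklore] -/
theorem pow_succ_le_two_rpow {c : ℝ} (hc : 0 < c) {a k : ℕ} (ha : 1 ≤ a)
    (hak : (4 * k + 4 : ℝ) ≤ c * a) :
    (((2 ^ a) ^ k + 1 : ℕ) : ℝ) ≤
      (2 : ℝ) ^ (c * (((2 ^ (16 * Nat.log 2 a) : ℕ) : ℝ)) ^ (1 / 8 : ℝ)) := by
  rw [rpow_m_eq]
  have har : (1 : ℝ) ≤ a := by exact_mod_cast ha
  -- `n^k + 1 ≤ 2^{ak+1}`
  have h1 : (((2 ^ a) ^ k + 1 : ℕ) : ℝ) ≤ (2 : ℝ) ^ ((a * k + 1 : ℕ) : ℝ) := by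
    rw [Real.rpow_natCast]
    have : (2 ^ a) ^ k + 1 ≤ 2 ^ (a * k + 1) := by
      rw [← pow_mul, pow_succ]
      have := Nat.one_le_two_pow (n := a * k)
      omega
    exact_mod_cast this
  -- `ak + 1 ≤ c · 2^{2ℓ}`
  have h2 : ((a * k + 1 : ℕ) : ℝ) ≤ c * (2 : ℝ) ^ (2 * Nat.log 2 a) := by
    have hsq : (a : ℝ) * a < 4 * (2 : ℝ) ^ (2 * Nat.log 2 a) := by
      exact_mod_cast sq_lt_four_mul_two_pow_log a
    have h3 : ((a * k + 1 : ℕ) : ℝ) ≤ (a : ℝ) * (k + 1) := by push_cast; nlinarith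
    have h4 : (a : ℝ) * (k + 1) * 4 ≤ c * a * a := by nlinarith
    nlinarith
  refine h1.trans (Real.rpow_le_rpow_of_exponent_le one_le_two (h2.trans ?_))
  exact le_rfl

/-- `m(a) = 2^{16 ⌊log₂ a⌋} → ∞`. [folklore] -/
theorem tendsto_m_atTop : Tendsto (fun a => 2 ^ (16 * Nat.log 2 a)) atTop atTop :=
  tendsto_atTop_mono (fun a => ((Nat.le_mul_of_pos_left _ (by norm_num)).trans
    (Nat.lt_two_pow_self).le)) tendsto_log2_atTop

/-- **T4 (`NegLimited.NeglimitedNearMarkovNegations`, stmt-PneNP-19862), verbatim, with `c = 32`.**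
One explicit `L ∈ P ⊆ NP` whose slices at the lengths `n = 2^a` need De Morgan circuits of size
`> n^k` under the NOT budget `⌊log₂ n⌋ - 32 ⌊log₂ ⌊log₂ n⌋⌋`, for every `k`, infinitely often.
[cite: Jukna2012, Thm. 10.21 (PDF pp. 310–311)] -/
theorem neglimitedNearMarkovNegations :
    ∃ L ∈ Literature.Computability.Complexity.Nondeterministic.NP, ∃ c : ℕ, ∀ k : ℕ,
      ∃ᶠ n : ℕ in Filter.atTop, n ^ k <
        Literature.Computability.Complexity.negLimitedSizeOver
          Literature.Computability.Complexity.deMorganBasis (Nat.log 2 n - c * Nat.log 2 (Nat.log 2 n))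
          (L.sliceFn n) := by
  obtain ⟨F, hFP, hspec⟩ := GLS1981_thetaApprox_unary_FP_holds
  have hF : IsThetaApprox F := hspec
  obtain ⟨c, hc, hJ⟩ := Jukna2012_cliqueLike_sqrt_lowerBound_holds
  refine ⟨nearMarkovLang F, nearMarkovLang_mem_NP hFP, 32, fun k => ?_⟩
  -- the bound at every large designed length `n = 2^a`
  have hev : ∀ᶠ a : ℕ in atTop, (2 ^ a) ^ k < negLimitedSizeOver deMorganBasis
      (Nat.log 2 (2 ^ a) - 32 * Nat.log 2 (Nat.log 2 (2 ^ a))) ((nearMarkovLang F).sliceFn (2 ^ a)) := by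
    filter_upwards [eventually_ge_atTop 256, tendsto_m_atTop.eventually hJ,
      tendsto_m_atTop.eventually (eventually_ge_atTop 4),
      eventually_ge_atTop (⌈(4 * k + 4 : ℝ) / c⌉₊)] with a h256 hJa hm4 hak
    have h32 := thirtytwo_mul_log_le h256
    rw [Nat.log_pow one_lt_two]
    apply Nat.lt_of_succ_le
    have hs := nmBlockLen_two_pow h32
    have hK := nmBlocks_two_pow h32
    rw [← blocks_mul_blockLen h32] at hs hK
    have hmain := le_negLimitedSizeOver_of_blocks hF hm4 hs hK (S := (2 ^ a) ^ k + 1)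
      fun f hf C hCB hCf => by
        have h1 := hJa f hf C hCB hCf
        have hak' : (4 * k + 4 : ℝ) ≤ c * a := by
          have := Nat.ceil_le.1 hak
          rw [div_le_iff₀ hc] at this
          linarith
        have h2 := pow_succ_le_two_rpow hc (by omega) hak'
        exact_mod_cast h2.trans h1
    rw [blocks_mul_blockLen h32] at hmain
    exact hmain
  -- infinitely often in `n`
  refine frequently_atTop.2 fun N => ?_
  obtain ⟨A, hA⟩ := eventually_atTop.1 hev
  exact ⟨2 ^ max A N, (le_max_right A N).trans Nat.lt_two_pow_self.le, hA _ (le_max_left _ _)⟩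

end Summit.PneNP.PneNP.Theorems.NegLimNearMarkov

namespace Summit.PneNP.PneNP.Theorems

/-- **stmt-PneNP-19862 (`NegLimited.NeglimitedNearMarkovNegations`, rung T4) PROVED, by name.**
[cite: Jukna2012, Thm. 10.21 (PDF pp. 310–311)] -/
theorem neglimitedNearMarkovNegations_holds :
    Summit.PneNP.PneNP.Theses.NegLimited.NeglimitedNearMarkovNegations :=
  NegLimNearMarkov.neglimitedNearMarkovNegations

end Summit.PneNP.PneNP.Theorems

end
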